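import Summits.BirchSwinnertonDyer.BirchSwinnertonDyer.Theorems.ByReductionTypeAtTwoTorsionEulerCharH46LevelZero
import Literature.NumberTheory.EllipticCurves.PointDivisibilityProofs
import HarnessLib

set_option linter.dupNamespace false -- `…BirchSwinnertonDyer.BirchSwinnertonDyer…` is the cell's nested layout (D-0017)
set_option autoImplicit false

/-!
# Brick B6-K of the H46 kernel programme: the Kummer sequence `0 → E[p^N] → E[p^∞] → E[p^∞] → 0` in cohomology over a layer
# (`push : H¹(H, E[p^N]) → H¹(H, E[p^∞])` is ONTO `H¹(H, E[p^∞])[p^N]`; `push ∘ r_* = p^{N−j} · push`)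

Cell `bsd-2adic` (run/shared/lean/pub/bsd-2adic/), seat `bsd-2adic-tower-1` GEN 36; `--supports stmt-BirchSwinnertonDyer-19271` (helper,
item `OrdKatoHalfAtTwo`, TOWER road; roadmap `HOME/tower/gen36/NOTE-B6-UNIVERSAL-NORMS-GEN36.md` §5′, input U1 / trick (T-a)). THEOREMS ONLY;
closes no item; nothing booked; BSD is not proved by any of this.

For a subgroup `H ≤ Γ_K` (any field `K`, elliptic `W`), `push = resH1Hom (id_H) (E[p^N] ↪ E[p^∞])` (the TP2 / GEN 35 spelling):
* `exists_push_eq_of_pow_nsmul_eq_zero` — **every `ξ ∈ H¹(H, E[p^∞])` with `p^N ξ = 0` is `push c` for some `c ∈ H¹(H, E[p^N])`**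
  (Kummer sequence, surjectivity half; `E(K̄)` is divisible — tree `zsmul_geomPoints_surjective_holds` — so `E[p^∞]` is `p`-divisible;
  cocycle correction as in `exists_map_torsionIncl_eq`);
* `push_eq_zero_iff_exists` — `push [g] = 0 ↔ g(σ) = σQ − Q` for some `Q ∈ E[p^∞]` (exactness at `H¹(H, E[p^N])`; `⇒` is GEN 35's
  `exists_eq_smul_sub_of_nsmul_push_eq_zero` with `c = 1`);
* `push_reduce_eq_pow_nsmul_push` — for a reduction `r : E[p^N] → E[p^j]` with values `p^{N−j}·P`: `push (r_* c) = p^{N−j} • push c`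
  (hence, (T-a): `p^{N−j} • push c = 0 ⟹ push (r_* c) = 0`).
[cite: SilvermanAEC2009, VIII.§2 (Kummer sequence), X.§4] [cite: SerreGaloisCohomology1997, I §2.2]
-/

noncomputable section

open scoped Classical ContRepresentation

namespace Summit.BirchSwinnertonDyer.BirchSwinnertonDyer.Theorems

namespace TorsionEulerChar.B6

open CategoryTheory Field WeierstrassCurve Literature.NumberTheory.EllipticCurves
  Literature.NumberTheory.GaloisRepresentations Literature.NumberTheory.GaloisRepresentations.DiscreteGaloisModule
open _root_.TopRep _root_.ContinuousCohomology
open Literature.Algebra.Homology.DiscreteRep (toTopRepHom)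

variable {K : Type} [Field K] (W : WeierstrassCurve K) [W.IsElliptic] (p : ℕ) [hp : Fact p.Prime]
  (H : Subgroup (absoluteGaloisGroup K))

/-- `E[p^∞] ⊆ E(K̄)` is `p`-divisible: every `v ∈ E[p^∞]` is `p^N • v'` with `v' ∈ E[p^∞]`. [cite: SilvermanAEC2009, VIII.§2] -/
theorem exists_pow_nsmul_eq_geomPrimaryTorsion (N : ℕ) (v : W.geomPrimaryTorsion p) :
    ∃ v' : W.geomPrimaryTorsion p, p ^ N • v' = v := by
  have hne : (((p : ℤ) ^ N)) ≠ 0 := by exact_mod_cast pow_ne_zero N hp.out.ne_zero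
  obtain ⟨Q, hQ⟩ := W.zsmul_geomPoints_surjective_holds hne (v : W.geomPoints)
  have hQ' : p ^ N • Q = (v : W.geomPoints) := by
    have h : (((p : ℤ) ^ N)) • Q = (v : W.geomPoints) := hQ
    rwa [← Nat.cast_pow, Nat.cast_smul_eq_nsmul] at h
  obtain ⟨k, hk⟩ := (PrimaryCoinvariants.mem_primaryComponent_iff_exists_nsmul p (v : W.geomPoints)).1 v.2
  have hQmem : Q ∈ W.geomPrimaryTorsion p := by
    refine (PrimaryCoinvariants.mem_primaryComponent_iff_exists_nsmul p Q).2 ⟨k + N, ?_⟩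
    rw [pow_add, mul_nsmul', hQ', hk]
  exact ⟨⟨Q, hQmem⟩, Subtype.ext (by rw [AddSubgroupClass.coe_nsmul]; exact hQ')⟩

/-- **Kummer surjectivity over `H`**: every `ξ ∈ H¹(H, E[p^∞])` killed by `p^N` is the push of a class of `H¹(H, E[p^N])`.
[cite: SilvermanAEC2009, VIII.§2, X.§4 (proof of X.4.2(a))] [cite: SerreGaloisCohomology1997, I §2.2] -/
theorem exists_push_eq_of_pow_nsmul_eq_zero (N : ℕ) (ξ : W.subgroupH1 p H) (hξ : p ^ N • ξ = 0) :
    ∃ c : W.torsionH1Over ((p : ℤ) ^ N) H,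
      resH1Hom (N := W.geomPrimaryTorsion p) (subgroupInclusion (le_refl H))
        (AddSubgroup.inclusion (AcSigned.geomTorsion_zpow_le_geomPrimaryTorsion W p N)) (fun _ _ ↦ rfl) c = ξ := by
  obtain ⟨φ, rfl⟩ := oneCocycleClass_surjective (discreteTopRep H (W.geomPrimaryTorsion p)) ξ
  -- `p^N φ` is principal
  rw [← Nat.cast_smul_eq_nsmul ℤ, ← oneCocycleClass_smul, oneCocycleClass_eq_zero_iff] at hξ
  obtain ⟨v, hv⟩ := hξ
  obtain ⟨v', rfl⟩ := exists_pow_nsmul_eq_geomPrimaryTorsion W p N v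
  -- the principal cocycle of `v'`
  have hst : IsOpen (MulAction.stabilizer H v' : Set H) := by
    have h1 : IsOpen (MulAction.stabilizer (absoluteGaloisGroup K) (v' : W.geomPoints) : Set (absoluteGaloisGroup K)) :=
      isOpen_stabilizer_point_holds W _
    have h2 : (MulAction.stabilizer H v' : Set H) =
        Subtype.val ⁻¹' (MulAction.stabilizer (absoluteGaloisGroup K) (v' : W.geomPoints) : Set (absoluteGaloisGroup K)) := by
      ext σ
      simp only [SetLike.mem_coe, MulAction.mem_stabilizer_iff, Set.mem_preimage, Subgroup.smul_def]
      rw [← Subtype.coe_inj, Literature.NumberTheory.EllipticCurves.primaryComponent.coe_smul]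
    rw [h2]
    exact h1.preimage continuous_subtype_val
  obtain ⟨π, hπ⟩ := exists_contOneCocycles_apply_eq_smul_sub (G := H) (M := W.geomPrimaryTorsion p) v' hst
  -- `ψ := φ − π` is killed by `p^N`
  have hψ : ∀ g, p ^ N • (φ - π).1 g = 0 := fun g ↦ by
    have h := hv g
    change (((p ^ N : ℕ) : ℤ)) • φ.1 g = g • (p ^ N • v') - p ^ N • v' at h
    rw [Nat.cast_smul_eq_nsmul] at h
    have hg : g • (p ^ N • v') = p ^ N • (g • v') := map_nsmul (DistribSMul.toAddMonoidHom _ g) (p ^ N) v'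
    change p ^ N • (φ.1 g - π.1 g) = 0
    rw [nsmul_sub, h, hπ, nsmul_sub, hg, sub_self]
  -- lift `ψ` to an `E[p^N]`-valued cocycle
  have hmem : ∀ g, ((((φ - π).1 g : W.geomPrimaryTorsion p)) : W.geomPoints) ∈ W.geomTorsion ((p : ℤ) ^ N) := fun g ↦ by
    rw [mem_geomTorsion_iff, ← Nat.cast_pow, Nat.cast_smul_eq_nsmul, ← AddSubgroupClass.coe_nsmul, hψ g, AddSubgroup.coe_zero]
  let ψA : contOneCocycles (discreteTopRep H (W.geomTorsion ((p : ℤ) ^ N))) :=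
    ⟨⟨fun g ↦ ⟨_, hmem g⟩, (continuous_subtype_val.comp (φ - π).1.continuous).subtype_mk _⟩, fun g h ↦ Subtype.ext (by
      have e := congrArg (fun P : W.geomPrimaryTorsion p ↦ (P : W.geomPoints)) ((φ - π).2 g h)
      change (((φ - π).1 (g * h) : W.geomPrimaryTorsion p) : W.geomPoints) =
        (((φ - π).1 g + (g : absoluteGaloisGroup K) • (φ - π).1 h : W.geomPrimaryTorsion p) : W.geomPoints) at e
      rw [AddMemClass.coe_add, Literature.NumberTheory.EllipticCurves.primaryComponent.coe_smul] at e
      change (((φ - π).1 (g * h) : W.geomPrimaryTorsion p) : W.geomPoints) =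
        (((φ - π).1 g : W.geomPrimaryTorsion p) : W.geomPoints) +
          (((g : absoluteGaloisGroup K) • (⟨_, hmem h⟩ : W.geomTorsion ((p : ℤ) ^ N)) : W.geomTorsion ((p : ℤ) ^ N)) :
            W.geomPoints)
      rw [Literature.NumberTheory.EllipticCurves.AddSubgroup.torsionBy.coe_smul]
      exact e)⟩
  refine ⟨oneCocycleClass _ ψA, ?_⟩
  rw [Literature.NumberTheory.EllipticCurves.resH1Hom_oneCocycleClass]
  have hpb : contOneCocycles.pullback (subgroupInclusion (le_refl H))
      (resHomOfEquivariant (subgroupInclusion (le_refl H))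
        (AddSubgroup.inclusion (AcSigned.geomTorsion_zpow_le_geomPrimaryTorsion W p N)) (fun _ _ ↦ rfl)) ψA = φ - π := by
    apply Subtype.ext
    ext g
    rfl
  rw [hpb, oneCocycleClass_sub, sub_eq_self, oneCocycleClass_eq_zero_iff]
  exact ⟨v', hπ⟩

omit [W.IsElliptic] hp in
/-- **Exactness at `H¹(H, E[p^N])`**: `push [g] = 0` iff `g(σ) = σQ − Q` for some `Q ∈ E[p^∞]` (as points of `E(K̄)`).
[cite: SilvermanAEC2009, VIII.§2] [cite: SerreGaloisCohomology1997, I §2.2] -/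
theorem push_eq_zero_iff_exists (N : ℕ) (g : contOneCocycles (discreteTopRep H (W.geomTorsion ((p : ℤ) ^ N)))) :
    resH1Hom (N := W.geomPrimaryTorsion p) (subgroupInclusion (le_refl H))
        (AddSubgroup.inclusion (AcSigned.geomTorsion_zpow_le_geomPrimaryTorsion W p N)) (fun _ _ ↦ rfl) (oneCocycleClass _ g) = 0 ↔
      ∃ Q : W.geomPrimaryTorsion p, ∀ σ : H,
        ((g.1 σ : W.geomTorsion ((p : ℤ) ^ N)) : W.geomPoints) = (σ : absoluteGaloisGroup K) • (Q : W.geomPoints) - (Q : W.geomPoints) := by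
  rw [CocycleCriteria.resH1Hom_oneCocycleClass_eq_zero_iff]
  constructor
  · rintro ⟨Q, hQ⟩
    refine ⟨Q, fun σ ↦ ?_⟩
    have e := congrArg (fun P : W.geomPrimaryTorsion p ↦ (P : W.geomPoints)) (hQ σ)
    have hσ : subgroupInclusion (le_refl H) σ = σ := Subtype.ext rfl
    rw [hσ] at e
    change ((g.1 σ : W.geomTorsion ((p : ℤ) ^ N)) : W.geomPoints) =
      ((((σ : absoluteGaloisGroup K) • Q - Q : W.geomPrimaryTorsion p)) : W.geomPoints) at e
    rwa [AddSubgroupClass.coe_sub, Literature.NumberTheory.EllipticCurves.primaryComponent.coe_smul] at e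
  · rintro ⟨Q, hQ⟩
    refine ⟨Q, fun σ ↦ Subtype.ext ?_⟩
    have hσ : subgroupInclusion (le_refl H) σ = σ := Subtype.ext rfl
    rw [hσ]
    change ((g.1 σ : W.geomTorsion ((p : ℤ) ^ N)) : W.geomPoints) =
      ((((σ : absoluteGaloisGroup K) • Q - Q : W.geomPrimaryTorsion p)) : W.geomPoints)
    rw [hQ σ, AddSubgroupClass.coe_sub, Literature.NumberTheory.EllipticCurves.primaryComponent.coe_smul]

omit [W.IsElliptic] hp in
/-- **`push ∘ r_* = p^{N−j} · push`** for a reduction map `r : E[p^N] → E[p^j]` with values `r(P) = p^{N−j} · P` (e.g. the tree's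
`torsionGaloisModulePowReduce`). In particular `p^{N−j} • push c = 0 ⟹ push (r_* c) = 0` (torsion absorption). [cite: SilvermanAEC2009, VIII.§2] -/
theorem push_reduce_eq_pow_nsmul_push {j N : ℕ}
    (r : (W.torsionGaloisModule ((p : ℤ) ^ N)).toContRepresentation →ⁱL
      (W.torsionGaloisModule ((p : ℤ) ^ j)).toContRepresentation)
    (hr : ∀ P : W.geomTorsion ((p : ℤ) ^ N),
      ((r P : W.geomTorsion ((p : ℤ) ^ j)) : W.geomPoints) = (p : ℤ) ^ (N - j) • (P : W.geomPoints))
    (c : W.torsionH1Over ((p : ℤ) ^ N) H) :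
    resH1Hom (N := W.geomPrimaryTorsion p) (subgroupInclusion (le_refl H))
        (AddSubgroup.inclusion (AcSigned.geomTorsion_zpow_le_geomPrimaryTorsion W p j)) (fun _ _ ↦ rfl)
        (cohomologyMap (subgroupRepHom (toTopRepHom (W.torsionGaloisModule ((p : ℤ) ^ N))
          (W.torsionGaloisModule ((p : ℤ) ^ j)) r) H) 1 c) =
      p ^ (N - j) • resH1Hom (N := W.geomPrimaryTorsion p) (subgroupInclusion (le_refl H))
        (AddSubgroup.inclusion (AcSigned.geomTorsion_zpow_le_geomPrimaryTorsion W p N)) (fun _ _ ↦ rfl) c := by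
  obtain ⟨g, rfl⟩ := oneCocycleClass_surjective (discreteTopRep H (W.geomTorsion ((p : ℤ) ^ N))) c
  have h1 : cohomologyMap (subgroupRepHom (toTopRepHom (W.torsionGaloisModule ((p : ℤ) ^ N))
      (W.torsionGaloisModule ((p : ℤ) ^ j)) r) H) 1 (oneCocycleClass (discreteTopRep H (W.geomTorsion ((p : ℤ) ^ N))) g) =
      oneCocycleClass (discreteTopRep H (W.geomTorsion ((p : ℤ) ^ j)))
        (contOneCocycles.pullback (ContinuousMonoidHom.id _) (resIdHom (subgroupRepHom (toTopRepHom
          (W.torsionGaloisModule ((p : ℤ) ^ N)) (W.torsionGaloisModule ((p : ℤ) ^ j)) r) H)) g) :=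
    cohomologyMap_oneCocycleClass (A := subgroupRep (W.torsionGaloisModule ((p : ℤ) ^ N)).toTopRep H) _ g
  rw [h1, Literature.NumberTheory.EllipticCurves.resH1Hom_oneCocycleClass, Literature.NumberTheory.EllipticCurves.resH1Hom_oneCocycleClass,
    ← Nat.cast_smul_eq_nsmul ℤ, ← oneCocycleClass_smul]
  congr 1
  apply Subtype.ext
  ext σ
  change ((AddSubgroup.inclusion (AcSigned.geomTorsion_zpow_le_geomPrimaryTorsion W p j)
      ((contOneCocycles.pullback (ContinuousMonoidHom.id _) (resIdHom (subgroupRepHom (toTopRepHom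
        (W.torsionGaloisModule ((p : ℤ) ^ N)) (W.torsionGaloisModule ((p : ℤ) ^ j)) r) H)) g).1
        (subgroupInclusion (le_refl H) σ)) : W.geomPrimaryTorsion p) : W.geomPoints) =
    ((((((p ^ (N - j) : ℕ) : ℤ)) • AddSubgroup.inclusion (AcSigned.geomTorsion_zpow_le_geomPrimaryTorsion W p N)
      (g.1 (subgroupInclusion (le_refl H) σ))) : W.geomPrimaryTorsion p) : W.geomPoints)
  have hσ : subgroupInclusion (le_refl H) σ = σ := Subtype.ext rfl
  rw [hσ, pullback_id_resIdHom_apply, subgroupRepHom_hom_apply, AddSubgroup.coe_inclusion, AddSubgroupClass.coe_zsmul,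
    AddSubgroup.coe_inclusion]
  change ((r (g.1 σ) : W.geomTorsion ((p : ℤ) ^ j)) : W.geomPoints) = _
  rw [hr, Nat.cast_pow]

end TorsionEulerChar.B6

end Summit.BirchSwinnertonDyer.BirchSwinnertonDyer.Theorems
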